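import Literature.NumberTheory.LFunctions.DirichletLRiemannHypothesisUpTo
import Literature.NumberTheory.LFunctions.SiegelZeroQualityBound
import Literature.Barriers.Parity.SiegelZeroPrimePairsNarrow
import HarnessLib

/-!
# No exceptional (Landau–Siegel) zero up to a level `Q`: the criterion of a certified table of real
# characters, its relation to `NoSiegelZeros`, and the printed range (Platt 2016)

Topic `Literature/NumberTheory/LFunctions`. One definition (`NoExceptionalZeroUpTo`, reviewed) and
THEOREMS (no named fact, no `sorry`).

The classical theory of primes in progressions is effective except for a possible real zero of
`L(s, χ)`, `χ` a quadratic primitive character mod `q`, in the window `1 − c₀/log q ≤ β < 1`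
(Montgomery–Vaughan §11.2; Davenport Ch. 14); the tree holds "no such zero, all `q`" as the OPEN
statement `NoSiegelZeros` (rh.S34, `RHWave0.lean`). A numerical verification establishes only the
FINITE-RANGE, EXPLICIT-CONSTANT truncation — the hypothesis of the explicit `ψ(x; q, a)` estimates of
Bennett–Martin–O'Bryant–Rechnitzer (Illinois J. Math. 62 (2018), Prop. 6.18: "suppose that no
quadratic Dirichlet `L`-function with conductor `q` has a real zero exceeding `1 − R₁/log q` … then
for all `x ≥ exp(max{κ₂, 4R₁ log² q})`, `|ψ(x; q, a) − x/φ(q)| ≤ x/(4 (log x)^Z)`"; ibid.: "this is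
the case, via Platt, for `10⁵ < q ≤ 4·10⁵`"). This file types that truncation once, so that certified
tables (DATA) and kernel consumers (PROOF-OF-DATA) share one `Prop`:

* `NoExceptionalZeroUpTo Q c₀` (NARROW): for `3 ≤ q ≤ Q`, `χ` quadratic primitive mod `q`, real
  `σ > 0` with `1 − c₀/log q ≤ σ ≤ 1`: `L(σ, χ) ≠ 0`. (The guard `σ > 0` — amendment A1 of the
  column's TARGET memo — keeps the trivial zeros `L(0, χ)`, `L(−1, χ)` out at widths `c₀ ≥ log q`.)
  Bookkeeping `anti_level`, `anti_const`, `of_nonpos`, `lfunction_ne_zero_of_le`; HONESTY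
  `noSiegelZeros_iff_forall_noExceptionalZeroUpTo : NoSiegelZeros ↔ ∃ c > 0, ∀ Q, NoExceptionalZeroUpTo Q c`
  (a table at one `Q` is an instance, never the conjecture); the consumers' forms
  `NoExceptionalZeroUpTo.lfunction_ne_zero` (all quadratic `χ ≠ χ₀` mod `q ≤ Q`, imprimitive included,
  via `χ⋆` of conductor `q⋆ ∣ q`, `LFunction_changeLevel`, MV (10.20)) and `one_sub_realZero_ge`
  (the real-zero hypothesis of `PageUniformPNT.exists_classicalPsiData_of_realZeros`).
* The printed range (STEP-0 of the column), conditional on the named fact `platt2016_theorem71`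
  of `DirichletLRiemannHypothesisUpTo.lean`: `NoExceptionalZeroUpTo.of_grhUpTo` (GRH to any height
  `T_q ≥ 0` clears every window with `2c₀ < log 3`) and `noExceptionalZeroUpTo_platt :
  platt2016_theorem71 → NoExceptionalZeroUpTo 400000 (1/2)`.

What is NOT here: the WIDE criterion "no real zero in `(0, 1)`" (`NoRealZeroUpTo.lean`), certificate
checkers / evaluators of `L(σ, χ)` (the data rung) and the consumers (exception-free regions,
`ψ(x; q, a)` bounds — sibling files).

## References

* D. J. Platt, *Numerical computations concerning the GRH*, Math. Comp. 85 (2016), 3009–3027,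
  Theorems 7.1–7.2. [Platt2016GRH]
* M. A. Bennett, G. Martin, K. O'Bryant, A. Rechnitzer, *Explicit bounds for primes in arithmetic
  progressions*, Illinois J. Math. 62 (2018), 427–532 = arXiv:1802.00085, Definition 6.1,
  Propositions 4.34, 6.18. [BennettMartinOBryantRechnitzer2018]
* H. L. Montgomery, R. C. Vaughan, *Multiplicative Number Theory I*, CUP 2007, §11.2, §10.1 (10.20).
  [MontgomeryVaughan2007]
* H. Davenport, *Multiplicative Number Theory*, 2nd ed., GTM 74, Ch. 14. [DavenportMNT1980]
-/

noncomputable section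

open Complex Literature.Barriers.Parity

namespace Literature.NumberTheory.LFunctions

/-! ### The criterion -/

/-- **No exceptional zero up to level `Q` with constant `c₀`.** For every modulus `q` with
`3 ≤ q ≤ Q`, every quadratic (`MulChar.IsQuadratic`) primitive Dirichlet character `χ` mod `q`,
and every real `σ > 0` in the closed window `1 − c₀/log q ≤ σ ≤ 1`, the Dirichlet `L`-function
(Mathlib's `DirichletCharacter.LFunction`, entire for `χ ≠ χ₀`) does not vanish at `σ`. The guard
`0 < σ` keeps the trivial zeros (`L(−1, χ) = 0` for odd `χ`, `L(0, χ) = 0` for even `χ ≠ χ₀`) out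
of the window when `c₀ ≥ log q`; at such widths the statement becomes the WIDE criterion
`NoRealZeroUpTo` (no real zero in `(0, 1)` at all; `NoRealZeroUpTo.lean`). This is
the finite-range, explicit-constant truncation of rh.S34 (`NoSiegelZeros`; the exact relation is
`noSiegelZeros_iff_forall_noExceptionalZeroUpTo`), i.e. the hypothesis "no quadratic Dirichlet
`L`-function with conductor `q` has a real zero exceeding `1 − 1/(R₁ log q)`" of
Bennett–Martin–O'Bryant–Rechnitzer, Prop. 6.18, imposed for all `q ≤ Q` at once (`c₀ = 1/R₁`) — a
statement that a certified computation establishes for a given `(Q, c₀)` (Platt 2016 gives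
`(4·10⁵, 1/2)`, `noExceptionalZeroUpTo_platt`). Quadratic primitive characters exist only at
conductors `q ≥ 3`, whence the harmless floor `3 ≤ q` (which also keeps `log q > 0`).
[cite: BennettMartinOBryantRechnitzer2018, Definition 6.1 and Proposition 6.18] -/
def NoExceptionalZeroUpTo (Q : ℕ) (c₀ : ℝ) : Prop :=
  ∀ (q : ℕ) [NeZero q], 3 ≤ q → q ≤ Q →
    ∀ χ : DirichletCharacter ℂ q, χ.IsQuadratic → χ.IsPrimitive →
      ∀ σ : ℝ, 0 < σ → 1 - c₀ / Real.log q ≤ σ → σ ≤ 1 → χ.LFunction σ ≠ 0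

/-! ### An elementary inequality -/

/-- For `q ≥ 3`, `log q ≥ log 3 > 1 > 0`. [folklore] -/
private theorem one_lt_log_of_three_le {q : ℕ} (hq : 3 ≤ q) : 1 < Real.log q := by
  have hq3 : (3 : ℝ) ≤ (q : ℝ) := by exact_mod_cast hq
  have hlog3 : 1 < Real.log 3 := by
    have h := Real.exp_one_lt_d9
    rw [Real.lt_log_iff_exp_lt (by norm_num)]
    linarith
  exact lt_of_lt_of_le hlog3 (Real.log_le_log (by norm_num) hq3)

namespace NoExceptionalZeroUpTo

variable {Q : ℕ} {c₀ : ℝ}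

/-! ### Bookkeeping -/

/-- The criterion is antitone in the level: a table to `Q` is one to every `Q' ≤ Q`.
[cite: BennettMartinOBryantRechnitzer2018, Proposition 6.18] -/
theorem anti_level (h : NoExceptionalZeroUpTo Q c₀) {Q' : ℕ} (hQ : Q' ≤ Q) :
    NoExceptionalZeroUpTo Q' c₀ :=
  fun q _ hq3 hqQ χ hquad hprim σ hσ0 hσ hσ1 ↦ h q hq3 (hqQ.trans hQ) χ hquad hprim σ hσ0 hσ hσ1

/-- The criterion is antitone in the constant: a window of width `c₀/log q` contains the window
of width `c₀'/log q` for `c₀' ≤ c₀`. [cite: BennettMartinOBryantRechnitzer2018, Proposition 6.18] -/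
theorem anti_const (h : NoExceptionalZeroUpTo Q c₀) {c₀' : ℝ} (hc : c₀' ≤ c₀) :
    NoExceptionalZeroUpTo Q c₀' := by
  intro q _ hq3 hqQ χ hquad hprim σ hσ0 hσ hσ1
  refine h q hq3 hqQ χ hquad hprim σ hσ0 ?_ hσ1
  have hlog : 0 < Real.log q := by linarith [one_lt_log_of_three_le hq3]
  have : c₀' / Real.log q ≤ c₀ / Real.log q := div_le_div_of_nonneg_right hc hlog.le
  linarith

/-- For `c₀ ≤ 0` the window `[1 − c₀/log q, 1]` is at most the point `σ = 1`, where `L(1, χ) ≠ 0`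
(`χ ≠ χ₀`, Mathlib's `DirichletCharacter.LFunction_ne_zero_of_one_le_re`): the criterion is then
trivially true at every level. [cite: MontgomeryVaughan2007, Theorem 4.9] -/
theorem of_nonpos (hc : c₀ ≤ 0) (Q : ℕ) : NoExceptionalZeroUpTo Q c₀ := by
  intro q _ hq3 _ χ _ hprim σ _ hσ hσ1
  have hlog : 0 < Real.log q := by linarith [one_lt_log_of_three_le hq3]
  have hdiv : c₀ / Real.log q ≤ 0 := div_nonpos_of_nonpos_of_nonneg hc hlog.le
  have hσ1' : σ = 1 := le_antisymm hσ1 (by linarith)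
  subst hσ1'
  have hne : χ ≠ 1 := SiegelZeroQuality.ne_one_of_isPrimitive hprim (by omega)
  exact DirichletCharacter.LFunction_ne_zero_of_one_le_re χ (Or.inl hne) (by simp)

/-- **The window may be opened upwards.** Under the criterion, for `3 ≤ q ≤ Q` and a quadratic
primitive `χ` mod `q`, `L(σ, χ) ≠ 0` for EVERY real `σ > 0` with `σ ≥ 1 − c₀/log q`: for `σ ≤ 1`
this is the criterion, for `σ ≥ 1` the non-vanishing of `L(s, χ)`, `χ ≠ χ₀`, on `Re s ≥ 1` (Mathlib;
Montgomery–Vaughan Theorem 4.9 at `σ = 1` and §11.1 beyond). [cite: MontgomeryVaughan2007, Theorem 4.9] -/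
theorem lfunction_ne_zero_of_le (h : NoExceptionalZeroUpTo Q c₀) {q : ℕ} [NeZero q] (hq3 : 3 ≤ q)
    (hqQ : q ≤ Q) (χ : DirichletCharacter ℂ q) (hquad : χ.IsQuadratic) (hprim : χ.IsPrimitive)
    {σ : ℝ} (hσ0 : 0 < σ) (hσ : 1 - c₀ / Real.log q ≤ σ) : χ.LFunction σ ≠ 0 := by
  rcases le_or_gt σ 1 with h1 | h1
  · exact h q hq3 hqQ χ hquad hprim σ hσ0 hσ h1
  · have hne : χ ≠ 1 := SiegelZeroQuality.ne_one_of_isPrimitive hprim (by omega)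
    exact DirichletCharacter.LFunction_ne_zero_of_one_le_re χ (Or.inl hne)
      (by simp only [Complex.ofReal_re]; exact h1.le)

/-! ### Relation to the conjecture rh.S34 -/

/-- **`NoSiegelZeros` is the level-uniform criterion.** The open conjecture rh.S34
(`Literature.NumberTheory.LFunctions.NoSiegelZeros`: some `c > 0` such that for all `q ≥ 3` and all
real primitive `χ` mod `q`, `L(σ, χ) ≠ 0` for `σ > 1 − c/log q`) holds if and only if ONE constant
`c > 0` makes `NoExceptionalZeroUpTo Q c` true at EVERY level `Q`. (`→`: halve the constant to pass
from the open to the closed window; `←`: shrink the constant to `min(c, (log 3)/2)`, so that the open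
window lies in `σ > 1/2 > 0`, take `Q = q` and open the window upwards.) So a certified
table at a fixed `Q` is an instance of the conjecture's truncation and is never to be read as
evidence for rh.S34 itself. [cite: DavenportMNT1980, Ch. 14] -/
theorem _root_.Literature.NumberTheory.LFunctions.noSiegelZeros_iff_forall_noExceptionalZeroUpTo :
    NoSiegelZeros ↔ ∃ c : ℝ, 0 < c ∧ ∀ Q : ℕ, NoExceptionalZeroUpTo Q c := by
  constructor
  · rintro ⟨c, hc, h⟩
    refine ⟨c / 2, by positivity, fun Q q _ hq3 _ χ hquad hprim σ _ hσ _ ↦ h q hq3 χ hquad hprim σ ?_⟩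
    have hlog : 0 < Real.log q := by linarith [one_lt_log_of_three_le hq3]
    have hpos : 0 < c / Real.log q := div_pos hc hlog
    have heq : c / 2 / Real.log q = (c / Real.log q) / 2 := by ring
    rw [heq] at hσ
    linarith
  · rintro ⟨c, hc, h⟩
    -- shrink the constant so that the open window stays inside `σ > 1/2 > 0`
    have hlog3pos : 0 < Real.log 3 := Real.log_pos (by norm_num)
    refine ⟨min c (Real.log 3 / 2), lt_min hc (by linarith), fun q _ hq3 χ hquad hprim σ hσ ↦ ?_⟩
    have hq3r : (3 : ℝ) ≤ q := by exact_mod_cast hq3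
    have hlog3 : Real.log 3 ≤ Real.log q := Real.log_le_log (by norm_num) hq3r
    have hlog : 0 < Real.log q := by linarith [one_lt_log_of_three_le hq3]
    have h1 : min c (Real.log 3 / 2) / Real.log q ≤ 1 / 2 := by
      rw [div_le_iff₀ hlog]
      linarith [min_le_right c (Real.log 3 / 2)]
    have h2 : min c (Real.log 3 / 2) / Real.log q ≤ c / Real.log q :=
      div_le_div_of_nonneg_right (min_le_left _ _) hlog.le
    exact (h q).lfunction_ne_zero_of_le hq3 le_rfl χ hquad hprim (by linarith) (by linarith)

/-! ### All quadratic characters, imprimitive ones included -/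

/-- **The criterion controls every quadratic non-principal character up to level `Q`.** Under
`NoExceptionalZeroUpTo Q c₀`: for every modulus `q ≤ Q`, every quadratic `χ ≠ χ₀` mod `q`
(imprimitive characters included) and every real `σ > 0` with `σ ≥ 1 − c₀/log q`, `L(σ, χ) ≠ 0`.
Proof: for `σ ≥ 1` Mathlib's non-vanishing on `Re s ≥ 1`; for `0 < σ < 1` write
`L(σ, χ) = L(σ, χ⋆) ∏_{p ∣ q} (1 − χ⋆(p) p^{−σ})` with `χ⋆` the primitive (quadratic) character of
conductor `q⋆ ∣ q` (Mathlib `LFunction_changeLevel`, Montgomery–Vaughan (10.20)); the factors are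
non-zero, `3 ≤ q⋆ ≤ q ≤ Q`, and `1 − c₀/log q⋆ ≤ 1 − c₀/log q ≤ σ` (here `c₀ > 0`, else `σ ≥ 1`).
[cite: MontgomeryVaughan2007, §10.1 (10.20) and Corollary 11.8] -/
theorem lfunction_ne_zero (h : NoExceptionalZeroUpTo Q c₀) {q : ℕ} [NeZero q] (hqQ : q ≤ Q)
    (χ : DirichletCharacter ℂ q) (hquad : χ.IsQuadratic) (hχ : χ ≠ 1) {σ : ℝ} (hσ0 : 0 < σ)
    (hσ : 1 - c₀ / Real.log q ≤ σ) : χ.LFunction σ ≠ 0 := by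
  rcases le_or_gt 1 σ with h1 | h1
  · exact DirichletCharacter.LFunction_ne_zero_of_one_le_re χ (Or.inl hχ)
      (by simp only [Complex.ofReal_re]; exact h1)
  -- `0 < σ < 1`: pass to the primitive character
  have hq3 : 3 ≤ q := SiegelZeroPrimePairBarrierNarrow.three_le_level_of_ne_one χ hχ
  have hlogq : 0 < Real.log q := by linarith [one_lt_log_of_three_le hq3]
  have hc0 : 0 < c₀ := by
    by_contra hc
    rw [not_lt] at hc
    have : c₀ / Real.log q ≤ 0 := div_nonpos_of_nonpos_of_nonneg hc hlogq.le
    linarith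
  haveI : NeZero χ.conductor := ⟨χ.conductor_ne_zero⟩
  set ψ := χ.primitiveCharacter with hψdef
  have hχψ : DirichletCharacter.changeLevel χ.conductor_dvd_level ψ = χ :=
    DirichletCharacter.changeLevel_primitiveCharacter χ
  have hψ1 : ψ ≠ 1 := fun h' => hχ (by rw [← hχψ, h', map_one])
  have hsq : χ ^ 2 = 1 := MulChar.isQuadratic_iff_sq_eq_one.mp hquad
  have hψsq : ψ ^ 2 = 1 :=
    DirichletCharacter.changeLevel_injective χ.conductor_dvd_level
      (by rw [map_pow, hχψ, hsq, map_one])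
  have hψquad : ψ.IsQuadratic := MulChar.isQuadratic_iff_sq_eq_one.mpr hψsq
  have hψprim : ψ.IsPrimitive := DirichletCharacter.primitiveCharacter_isPrimitive χ
  have hd3 : 3 ≤ χ.conductor := SiegelZeroPrimePairBarrierNarrow.three_le_level_of_ne_one ψ hψ1
  have hdq : χ.conductor ≤ q := Nat.le_of_dvd (by omega) χ.conductor_dvd_level
  intro hL
  have hLψ : ψ.LFunction σ = 0 := by
    have hfac := DirichletCharacter.LFunction_changeLevel χ.conductor_dvd_level ψ
      (s := (σ : ℂ)) (Or.inl hψ1)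
    rw [hχψ] at hfac
    rw [hfac] at hL
    rcases mul_eq_zero.mp hL with h' | h'
    · exact h'
    · exact absurd h' (Finset.prod_ne_zero_iff.mpr fun p hp =>
        SiegelZeroPrimePairBarrierNarrow.one_sub_mul_cpow_ne_zero ψ (Nat.prime_of_mem_primeFactors hp).two_le hσ0)
  have hlogd0 : 0 < Real.log χ.conductor := by linarith [one_lt_log_of_three_le hd3]
  have hlogdq : Real.log χ.conductor ≤ Real.log q :=
    Real.log_le_log (by exact_mod_cast (show 0 < χ.conductor by omega)) (by exact_mod_cast hdq)
  have hwin : 1 - c₀ / Real.log χ.conductor ≤ σ := by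
    have : c₀ / Real.log q ≤ c₀ / Real.log χ.conductor :=
      div_le_div_of_nonneg_left hc0.le hlogd0 hlogdq
    linarith
  exact h χ.conductor hd3 (hdq.trans hqQ) ψ hψquad hψprim σ hσ0 hwin h1.le hLψ

/-- **Real zeros under the criterion, in the form the Landau–Page machinery consumes**
(`PageUniformPNT.exists_classicalPsiData_of_realZeros` asks: "every real zero `β` of every
quadratic `χ ≠ χ₀` mod `q` has `η ≤ 1 − β`"). Under `NoExceptionalZeroUpTo Q c₀` with `c₀ > 0`:
for `q ≤ Q`, any `T ≥ 1` with `log q ≤ T`, every quadratic `χ ≠ χ₀` mod `q` and every real zero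
`β` of `L(s, χ)`, `min(c₀, 1)/T ≤ 1 − β`. (A zero `β ≤ 0` has `1 − β ≥ 1`; a zero `β > 0` lies
strictly below the window, `β < 1 − c₀/log q ≤ 1 − c₀/T`, by `lfunction_ne_zero`.)
[cite: MontgomeryVaughan2007, Corollary 11.8] -/
theorem one_sub_realZero_ge (h : NoExceptionalZeroUpTo Q c₀) (hc0 : 0 < c₀) {q : ℕ} [NeZero q]
    (hqQ : q ≤ Q) {T : ℝ} (hT1 : 1 ≤ T) (hTq : Real.log q ≤ T) (χ : DirichletCharacter ℂ q)
    (hquad : χ.IsQuadratic) (hχ : χ ≠ 1) {β : ℝ} (hβ : χ.LFunction β = 0) :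
    min c₀ 1 / T ≤ 1 - β := by
  have hT0 : 0 < T := by linarith
  have hmin1 : min c₀ 1 / T ≤ 1 := by
    rw [div_le_one hT0]; exact (min_le_right _ _).trans hT1
  rcases le_or_gt β 0 with hβ0 | hβ0
  · linarith
  · -- `β > 0`: `β` lies strictly below the window `1 − c₀/log q`
    have hq3 : 3 ≤ q := SiegelZeroPrimePairBarrierNarrow.three_le_level_of_ne_one χ hχ
    have hlogq : 0 < Real.log q := by linarith [one_lt_log_of_three_le hq3]
    have hlt : β < 1 - c₀ / Real.log q := by
      by_contra hle
      rw [not_lt] at hle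
      exact h.lfunction_ne_zero hqQ χ hquad hχ hβ0 hle hβ
    have h1 : min c₀ 1 / T ≤ c₀ / Real.log q :=
      calc min c₀ 1 / T ≤ c₀ / T := div_le_div_of_nonneg_right (min_le_left _ _) hT0.le
        _ ≤ c₀ / Real.log q := div_le_div_of_nonneg_left hc0.le hlogq hTq
    linarith

/-! ### The printed range: GRH verified up to a height (Platt 2016) -/

/-- **GRH up to a height clears the window.** If for every modulus `3 ≤ q ≤ Q` GRH mod `q` holds
up to some height `T_q ≥ 0` (`GRHUpTo q (T q)`: every zero of every `L(s, χ)`, `χ ≠ χ₀` mod `q`,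
with `0 < Re s < 1`, `|Im s| ≤ T_q` has `Re s = 1/2`), then `NoExceptionalZeroUpTo Q c₀` for every
`c₀` with `2c₀ < log 3`: a zero `σ` in the window has `Im σ = 0 ≤ T_q` and
`1/2 < 1 − c₀/log q ≤ σ < 1` (`log q ≥ log 3`), contradicting `Re σ = 1/2`; and `L(1, χ) ≠ 0`.
[cite: Platt2016GRH, Theorem 3.2] -/
theorem of_grhUpTo {T : ℕ → ℝ} (hT : ∀ q, 0 ≤ T q)
    (hG : ∀ (q : ℕ) [NeZero q], 3 ≤ q → q ≤ Q → GRHUpTo q (T q)) (hc : 2 * c₀ < Real.log 3) :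
    NoExceptionalZeroUpTo Q c₀ := by
  intro q _ hq3 hqQ χ _ hprim σ _ hσ hσ1
  have hne : χ ≠ 1 := SiegelZeroQuality.ne_one_of_isPrimitive hprim (by omega)
  rcases eq_or_lt_of_le hσ1 with rfl | hlt
  · exact DirichletCharacter.LFunction_ne_zero_of_one_le_re χ (Or.inl hne) (by simp)
  · intro hL
    have hq3r : (3 : ℝ) ≤ q := by exact_mod_cast hq3
    have hlog3 : Real.log 3 ≤ Real.log q := Real.log_le_log (by norm_num) hq3r
    have hlogq : 0 < Real.log q := by linarith [one_lt_log_of_three_le hq3]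
    have hhalf : 1 / 2 < σ := by
      have h1 : c₀ / Real.log q < 1 / 2 := by
        rw [div_lt_iff₀ hlogq]; linarith
      linarith
    have hre := hG q hq3 hqQ χ hne (σ : ℂ) hL (by simp only [Complex.ofReal_re]; linarith)
      (by simpa only [Complex.ofReal_re] using hlt) (by simp only [Complex.ofReal_im, abs_zero]; exact hT q)
    simp only [Complex.ofReal_re] at hre
    linarith

/-- `log 3 > 1`: the constant `c₀ = 1/2` is admissible in `of_grhUpTo`. [folklore] -/
private theorem two_mul_half_lt_log_three : 2 * (1 / 2 : ℝ) < Real.log 3 := by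
  have := one_lt_log_of_three_le (le_refl 3)
  norm_num at this ⊢
  exact this

/-- **Platt's range.** From `platt2016_theorem71` (GRH for every primitive `χ` mod
`1 < q ≤ 400 000` to height `plattHeight q ≥ 10⁸/q`; transferred to every `χ ≠ χ₀` mod `q` by
`grhUpTo_of_platt2016`): `NoExceptionalZeroUpTo 400000 c₀` for every `c₀` with `2c₀ < log 3`.
Bennett–Martin–O'Bryant–Rechnitzer after Cor. 6.17: "If `q` is a modulus for which the
corresponding quadratic `L`-functions have no exceptional zero … this is the case, via Platt, for
`10⁵ < q ≤ 4·10⁵`." [cite: Platt2016GRH, Theorem 7.1] -/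
theorem of_platt2016 (hP : platt2016_theorem71) (hc : 2 * c₀ < Real.log 3) :
    NoExceptionalZeroUpTo 400000 c₀ :=
  of_grhUpTo (T := fun q ↦ 10 ^ 8 / (q : ℝ)) (fun q ↦ by positivity)
    (fun q _ _ hqQ ↦ grhUpTo_of_platt2016 hP hqQ) hc

end NoExceptionalZeroUpTo

/-- **The instance of record of the printed range**: Platt's Theorem 7.1 gives the criterion at
level `Q = 400 000` with constant `c₀ = 1/2`, i.e. no real primitive `χ` mod `3 ≤ q ≤ 4·10⁵` has a
zero of `L(s, χ)` in `[1 − 1/(2 log q), 1]`. (Conditional on the named fact `platt2016_theorem71`,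
a certified computation that the tree does not reproduce.) [cite: Platt2016GRH, Theorem 7.1] -/
theorem noExceptionalZeroUpTo_platt (hP : platt2016_theorem71) :
    NoExceptionalZeroUpTo 400000 (1 / 2) :=
  NoExceptionalZeroUpTo.of_platt2016 hP NoExceptionalZeroUpTo.two_mul_half_lt_log_three


end Literature.NumberTheory.LFunctions

end
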